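import Summits.QuantumFields.YangMills.Theorems.FluctuationComparisonRegPrIntLSectionTubeSplit
import HarnessLib

/-!
# FV∘ — THE K-FREE CONDITIONAL-HAAR TUBE-VOLUME FLOOR OF LINE g22-6 «tube_harnack» — FROM THE SETWISE TUBE LETTER ⟨HAAR-TUBE₁⟩ BY DISINTEGRATION, NO COAREA
# (crux `UnitScaleTilt.FluctuationComparisonRegPrIntL`, stmt-QuantumFields-20520; row FV∘ `FibreTubeVolumeCan` of `Cruxes/FluctuationComparisonRegPrIntL/Lines/tube_harnack.lean`
# ll.174–190, ideator ym-r3-idea-1 g22; seat ym3-torus-px20 g11)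

The row.  FV∘ `FibreTubeVolumeCan` (LINE g22-6, «size M–L as mathematics, L as formalisation: no coarea formula in Mathlib»): in TUBE∘'s prefix, for every measurable
admissible section `σ` of the one-step averaging over the interior window and every radius `r > 0` there is `v > 0` with: for `(dU_{J+1}.map D_{J,J+1})`-almost
every interior datum `U`, the conditional Haar law `λ_U = condLaw dU_{J+1} D_{J,J+1} U` of the one-step fibre gives mass `≥ v` to `tube_r(σ U) ∩ {PlaqSmall 2θ_{J+1}(b₀)}`.
With the card's own junction ✓`sectionTubeMass_of_harnack_volume : FH∘ → FV∘ → TUBE∘` this leaves TUBE∘ ⟸ FH∘ (the `K`-uniform fibre Harnack constant) alone.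

The proof (no coarea, no fibre manifold).  §1 is the CONVERSE of LEAD w3-20520 g18's fibrewise ⇒ setwise door (✓`…SectionTubeFibrewise.mul_le_withDensity_preimage_inter_of_fibrewise`):
a SETWISE charge `q·ν(D⁻¹B) ≤ ν(D⁻¹B ∩ T)` for all measurable `B` inside a window `W` IS the a.e. FIBREWISE charge `q ≤ κ_U(T)` of the conditional law `κ = condLaw ν D`
on `W` — disintegration ✓C `…SupTailFibreOdds.withDensity_preimage_inter_eq_lintegral_condLaw` (at `w ≡ 1`) turns both sides into `B`-integrals against `ν.map D`, and
Mathlib's `ae_le_of_forall_setLIntegral_le_of_sigmaFinite` reads off the densities; for a MOVING target `T = {V | V ∈ R (D V)}` the kernel lives on the fibre `{D V = U}`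
(lit ✓`condLaw_fibre_ae`), where `T` and `R U` coincide (`condLaw_apply_ge_of_setwise_moving`).  §2 feeds it the setwise letter ⟨HAAR-TUBE₁⟩ of LEAD's TUBE∘-SPLIT
(✓`…SectionTubeSplit.sectionTubeMassIntCan_of_up_low_haarTube`, conjunct ll.234–242 — the one-step Haar tube charge around admissible sections, [Balaban1985Averaging]
Prop. 1-type) at the reduced radius `r′ = min r (θ_{J+1}(b₀)∕4)`, so that `tube_{r′}(σ U) ⊆ tube_r(σ U) ∩ {PlaqSmall 2θ_{J+1}(b₀)}` (✓`plaqSmall_of_linkTube`): `v := q′(r′)`.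
The letter is the HYPOTHESIS of ★★★`fibreTubeVolumeCan_of_haarTube`, stated in the export shape of w4-20520 g18's `…HaarTubeNoMargin.haarTube_noMargin_depthOne`
(FV∘'s prefix with `γ₁ ≤ 1`; charts at the doubled profile over ✓`…HaarTubeLocalCharge`), which discharges it by name.

HONEST SCOPE.  Def-free, sorry-free measure theory; conclusion = the row text of FV∘ BYTE FOR BYTE (door-fit `Iff.rfl` against `Lines/tube_harnack.lean` in any file seeing
both).  ⟨HAAR-TUBE₁⟩ (no margin) is a HYPOTHESIS here; FH∘ ∕ TUBE∘ ∕ PERS₁∘ ∕ the crux `FluctuationComparisonRegPrIntL` (stmt-QuantumFields-20520) ∕ `YM3TorusSU2` are NOT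
proved; rung R3 = SU(2) YM₃ on T³ — NOT d = 4, NOT infinite volume, NOT a mass gap, NOT Clay.  HYP-SAT (cell RULING №42): the hypothesis is DISPLAYED at FV∘'s own
quantifier order (`q′` after `F, γ, J, r, σ`), K-free, satisfiable on the literal T³ families modulo [Balaban1985Averaging] Prop. 1 read through WREG's window charts.

References: T. Bałaban, CMP 98 (1985) 17–51 [Balaban1985Averaging] ((10) p.19, Prop. 1 p.22); CMP 109 (1987) 249–301 [Balaban1987RG1] ((0.11) p.253);
CMP 102 (1985) 255–275 [Balaban1985UV3] ((7) p.257, (38)–(40) p.266).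
-/

noncomputable section

set_option autoImplicit false

open MeasureTheory ProbabilityTheory Filter Topology Set
open scoped ENNReal NNReal
open Literature.MathematicalPhysics.QuantumFieldTheory.Balaban1983to89
open Literature.MathematicalPhysics.QuantumFieldTheory.Balaban1983to89.T3ContinuumYM3Torus
open Literature.MathematicalPhysics.QuantumFieldTheory.Balaban1983to89.T3NestedUnitLaws
open Literature.MathematicalPhysics.QuantumFieldTheory.Balaban1983to89.T3UnitLawDensityEML
open Literature.MathematicalPhysics.QuantumFieldTheory.Balaban1983to89.T3UnitScaleTilt
open Literature.MathematicalPhysics.QuantumFieldTheory.Balaban1983to89.T3TiltDescent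
open Literature.MathematicalPhysics.QuantumFieldTheory.Balaban1983to89.T3MinimiserStabilityReduction (θBal_pos)
open Literature.MathematicalPhysics.QuantumFieldTheory.Balaban1983to89.Missing
open Literature.MathematicalPhysics.QuantumFieldTheory.Balaban1983to89.T4AveragingDisintegration
open Summit.QuantumFields.YangMills.Theorems.FluctuationComparisonRegPrIntLSupTailFibreOdds (withDensity_preimage_inter_eq_lintegral_condLaw)
open Summit.QuantumFields.YangMills.Theorems.FluctuationComparisonRegPrIntLSectionTubeSplit (measurableSet_linkTube plaqSmall_of_linkTube)

namespace Summit.QuantumFields.YangMills.Theorems.FluctuationComparisonRegPrIntLFibreTubeVolume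

/-! ## §1 Generic: a SETWISE charge over a window is an a.e. FIBREWISE charge of the conditional law -/

section Generic

variable {α β : Type*} [MeasurableSpace α] [MeasurableSpace β] [StandardBorelSpace β] [Nonempty β]

/-- ★★ **SETWISE CHARGE ⇒ FIBREWISE CHARGE** (converse of ✓`…SectionTubeFibrewise.mul_le_withDensity_preimage_inter_of_fibrewise` at weight `1`): `ν` finite on a
standard Borel fine space, `D` measurable, `W` a measurable window, `T` a measurable fine set.  If `q·ν(D⁻¹B) ≤ ν(D⁻¹B ∩ T)` for every measurable `B ⊆ W`, then for
`(ν.map D)`-almost every `U ∈ W` the conditional law gives `q ≤ condLaw ν D U T`.  (Both sides are `B`-integrals against `ν.map D` — ✓`withDensity_preimage_inter_eq_lintegral_condLaw`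
— and `ae_le_of_forall_setLIntegral_le_of_sigmaFinite` compares the densities on `(ν.map D)⌊W`.) [cite: Balaban1985Averaging, (10) p.19] -/
theorem condLaw_apply_ge_of_setwise (ν : Measure β) [IsFiniteMeasure ν] {D : β → α} (hD : Measurable D)
    {W : Set α} (hW : MeasurableSet W) {T : Set β} (hT : MeasurableSet T) {q : ℝ≥0∞}
    (h : ∀ B : Set α, MeasurableSet B → B ⊆ W → q * ν (D ⁻¹' B) ≤ ν (D ⁻¹' B ∩ T)) :
    ∀ᵐ U ∂(ν.map D), U ∈ W → q ≤ condLaw ν D U T := by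
  have hle : ∀ᵐ U ∂((ν.map D).restrict W), (fun _ => q) U ≤ condLaw ν D U T := by
    refine ae_le_of_forall_setLIntegral_le_of_sigmaFinite measurable_const fun s hs _ => ?_
    rw [Measure.restrict_restrict hs]
    have hB : MeasurableSet (s ∩ W) := hs.inter hW
    have h1 : ∫⁻ _ in s ∩ W, q ∂(ν.map D) = q * ν (D ⁻¹' (s ∩ W)) := by
      rw [setLIntegral_const, Measure.map_apply hD hB]
    have h2 : ∫⁻ U in s ∩ W, condLaw ν D U T ∂(ν.map D) = ν (D ⁻¹' (s ∩ W) ∩ T) := by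
      have e := withDensity_preimage_inter_eq_lintegral_condLaw ν hD (w := fun _ => (1 : ℝ≥0∞)) measurable_const hB hT
      have hone : ν.withDensity (fun _ => (1 : ℝ≥0∞)) = ν := withDensity_one
      rw [hone] at e
      rw [e]
      refine setLIntegral_congr_fun hB (fun U _ => ?_)
      rw [setLIntegral_one]
    rw [h1, h2]
    exact h _ hB Set.inter_subset_right
  exact (ae_restrict_iff' hW).1 hle

/-- ★★ **THE SAME FOR A MOVING TARGET**: if the fine target is `{V | V ∈ R (D V)}` for a family `R` of fine events indexed by the datum, then for `(ν.map D)`-a.e. `U ∈ W`: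
`q ≤ condLaw ν D U (R U)` — the kernel gives full mass to the fibre `{D V = U}` (lit ✓`condLaw_fibre_ae`), on which the moving target and `R U` coincide.
[cite: Balaban1985Averaging, (10) p.19] -/
theorem condLaw_apply_ge_of_setwise_moving (ν : Measure β) [IsFiniteMeasure ν] {D : β → α} (hD : Measurable D) [MeasurableEq α]
    {W : Set α} (hW : MeasurableSet W) (R : α → Set β) (hT : MeasurableSet {V : β | V ∈ R (D V)}) {q : ℝ≥0∞}
    (h : ∀ B : Set α, MeasurableSet B → B ⊆ W → q * ν (D ⁻¹' B) ≤ ν (D ⁻¹' B ∩ {V : β | V ∈ R (D V)})) :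
    ∀ᵐ U ∂(ν.map D), U ∈ W → q ≤ condLaw ν D U (R U) := by
  filter_upwards [condLaw_apply_ge_of_setwise ν hD hW hT h, condLaw_fibre_ae ν hD] with U hU hfib hUW
  have hc : condLaw ν D U {V : β | D V = U}ᶜ = 0 :=
    (prob_compl_eq_zero_iff (measurableSet_eq_fun hD measurable_const)).2 hfib
  calc q ≤ condLaw ν D U {V : β | V ∈ R (D V)} := hU hUW
    _ = condLaw ν D U ({V : β | V ∈ R (D V)} ∩ {V : β | D V = U}) := (measure_inter_conull hc).symm
    _ = condLaw ν D U (R U ∩ {V : β | D V = U}) := by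
        congr 1
        ext V
        simp only [Set.mem_inter_iff, Set.mem_setOf_eq]
        exact and_congr_left fun hV => by rw [hV]
    _ ≤ condLaw ν D U (R U) := measure_mono Set.inter_subset_left

end Generic

/-! ## §2 FV∘ from the setwise one-step tube letter ⟨HAAR-TUBE₁⟩ -/

section Row

/-- ★★★ **FV∘ `FibreTubeVolumeCan` ⟸ ⟨HAAR-TUBE₁⟩** (the row text of `Lines/tube_harnack.lean` ll.174–190 VERBATIM as conclusion).  Hypothesis ⟨HAAR-TUBE₁⟩ = LEAD w3-20520
g18's one-step setwise Haar tube letter (✓`…SectionTubeSplit` ll.234–242) in the prefix of w4-20520 g18's `haarTube_noMargin_depthOne` (FV∘'s with `γ₁ ≤ 1`): for every measurable admissible section `σ` over the interior window and radius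
`r > 0`, ONE `q′ > 0` with `ofReal q′·dU_{J+1}(D⁻¹B) ≤ dU_{J+1}(D⁻¹B ∩ {V | ∀ b, dist1 ((σ (D V) b)⁻¹·V b) < r})` for all measurable interior `B`.  PROOF: at the reduced radius
`r′ := min r (θ_{J+1}(b₀)∕4)` the tube around the small `σ U` (`PlaqSmall θ_{J+1}(b₀)`) is inside `{PlaqSmall 2θ_{J+1}(b₀)}` (✓`plaqSmall_of_linkTube`), and §1 converts the
setwise letter into the conditional-law floor `ofReal q′ ≤ λ_U(tube_{r′}(σ U))` for a.e. interior `U`; `v := q′(r′)`.  NO coarea: the conditional Haar law is handled only through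
its disintegration identity.  [cite: Balaban1985Averaging, (10) p.19 and Prop. 1 p.22; Balaban1987RG1, (0.11) p.253; Balaban1985UV3, (7) p.257] -/
theorem fibreTubeVolumeCan_of_haarTube
    (h : ∀ (L : ℕ), ∃ c₀ : ℝ, 0 < c₀ ∧ c₀ ≤ 1 ∧ ∀ (c : ℝ), 0 < c → c ≤ c₀ → ∃ pS : ℝ, ∀ (b₀ p₀ : ℝ), 0 < b₀ → pS ≤ p₀ → 0 < p₀ →
      ∃ γ₁ : ℝ, 0 < γ₁ ∧ γ₁ ≤ 1 ∧ ∀ (F : T3Family) (γ : ℝ), F.L = L → 0 < γ → γ ≤ γ₁ →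
        ∀ (J : ℕ) (r : ℝ), 0 < r →
          ∀ σ : GaugeField (F.P J) 0 (Matrix.specialUnitaryGroup (Fin 2) ℂ) → GaugeField (F.P (J + 1)) 0 (Matrix.specialUnitaryGroup (Fin 2) ℂ), Measurable σ →
            (∀ U : GaugeField (F.P J) 0 (Matrix.specialUnitaryGroup (Fin 2) ℂ), PlaqSmall (θBal F.L γ (c * b₀) p₀ J) U →
              descendTo F ℰp J (J + 1) (Nat.le_succ J) (σ U) = U ∧ PlaqSmall (θBal F.L γ b₀ p₀ (J + 1)) (σ U)) →
            ∃ q' : ℝ, 0 < q' ∧ ∀ (B : Set (GaugeField (F.P J) 0 (Matrix.specialUnitaryGroup (Fin 2) ℂ))), MeasurableSet B →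
              B ⊆ {U | PlaqSmall (θBal F.L γ (c * b₀) p₀ J) U} →
              ENNReal.ofReal q' * fieldMeasure (F.P (J + 1)) 0 (Matrix.specialUnitaryGroup (Fin 2) ℂ) (descendTo F ℰp J (J + 1) (Nat.le_succ J) ⁻¹' B) ≤
                fieldMeasure (F.P (J + 1)) 0 (Matrix.specialUnitaryGroup (Fin 2) ℂ) (descendTo F ℰp J (J + 1) (Nat.le_succ J) ⁻¹' B ∩
                  {V | ∀ b : PBond (F.P (J + 1)) 0, dist1 ((σ (descendTo F ℰp J (J + 1) (Nat.le_succ J) V) b)⁻¹ * V b) < r})) :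
    ∀ (L : ℕ), ∃ c₀ : ℝ, 0 < c₀ ∧ c₀ ≤ 1 ∧ ∀ (c : ℝ), 0 < c → c ≤ c₀ → ∃ pS : ℝ, ∀ (b₀ p₀ : ℝ), 0 < b₀ → pS ≤ p₀ → 0 < p₀ →
      ∃ γ₁ : ℝ, 0 < γ₁ ∧ ∀ (F : T3Family) (γ : ℝ), F.L = L → 0 < γ → γ ≤ γ₁ →
        ∀ (J : ℕ) (r : ℝ), 0 < r →
          ∀ σ : GaugeField (F.P J) 0 (Matrix.specialUnitaryGroup (Fin 2) ℂ) → GaugeField (F.P (J + 1)) 0 (Matrix.specialUnitaryGroup (Fin 2) ℂ), Measurable σ →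
            (∀ U : GaugeField (F.P J) 0 (Matrix.specialUnitaryGroup (Fin 2) ℂ), PlaqSmall (θBal F.L γ (c * b₀) p₀ J) U →
              descendTo F ℰp J (J + 1) (Nat.le_succ J) (σ U) = U ∧ PlaqSmall (θBal F.L γ b₀ p₀ (J + 1)) (σ U)) →
            ∃ v : ℝ, 0 < v ∧
              ∀ᵐ U ∂((fieldMeasure (F.P (J + 1)) 0 (Matrix.specialUnitaryGroup (Fin 2) ℂ)).map (descendTo F ℰp J (J + 1) (Nat.le_succ J))),
                PlaqSmall (θBal F.L γ (c * b₀) p₀ J) U →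
                  ENNReal.ofReal v ≤
                    (condLaw (fieldMeasure (F.P (J + 1)) 0 (Matrix.specialUnitaryGroup (Fin 2) ℂ)) (descendTo F ℰp J (J + 1) (Nat.le_succ J)) U)
                      {W | (∀ b : PBond (F.P (J + 1)) 0, dist1 ((σ U b)⁻¹ * W b) < r) ∧ PlaqSmall (2 * θBal F.L γ b₀ p₀ (J + 1)) W} := by
  intro L
  obtain ⟨c₀, hc₀, hc₀1, hc⟩ := h L
  refine ⟨c₀, hc₀, hc₀1, fun c hcpos hcle => ?_⟩
  obtain ⟨pS, hpS⟩ := hc c hcpos hcle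
  refine ⟨pS, fun b₀ p₀ hb₀ hpS' hp₀ => ?_⟩
  obtain ⟨γ₁, hγ₁, hγ₁1, hγ₁F⟩ := hpS b₀ p₀ hb₀ hpS' hp₀
  refine ⟨γ₁, hγ₁, fun F γ hFL hγ hγle J r hr σ hσm hadm => ?_⟩
  have hγ1 : γ ≤ 1 := hγle.trans hγ₁1
  have hL1 : 1 ≤ F.L := F.hL.2.le
  -- reduce the radius: `r′ := min r (θ_{J+1}(b₀)/4)`
  have hθ : 0 < θBal F.L γ b₀ p₀ (J + 1) := θBal_pos hL1 hγ hγ1 hb₀ p₀ (J + 1)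
  set r' : ℝ := min r (θBal F.L γ b₀ p₀ (J + 1) / 4) with hr'_def
  have hr' : 0 < r' := lt_min hr (by positivity)
  have hr'r : r' ≤ r := min_le_left _ _
  have hr'θ : 4 * r' ≤ θBal F.L γ b₀ p₀ (J + 1) := by
    have := min_le_right r (θBal F.L γ b₀ p₀ (J + 1) / 4)
    linarith
  obtain ⟨q', hq', hB⟩ := hγ₁F F γ hFL hγ hγle J r' hr' σ hσm hadm
  refine ⟨q', hq', ?_⟩
  have hD : Measurable (descendTo F ℰp J (J + 1) (Nat.le_succ J)) := measurable_descendTo F ℰp measurableE_ℰp _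
  have hW : MeasurableSet {U : GaugeField (F.P J) 0 (Matrix.specialUnitaryGroup (Fin 2) ℂ) | PlaqSmall (θBal F.L γ (c * b₀) p₀ J) U} :=
    measurableSet_plaqSmall _
  have hT := measurableSet_linkTube (P := F.P (J + 1)) (j := 0) hσm hD r'
  have hae := condLaw_apply_ge_of_setwise_moving (fieldMeasure (F.P (J + 1)) 0 (Matrix.specialUnitaryGroup (Fin 2) ℂ)) hD hW
    (fun U => {V : GaugeField (F.P (J + 1)) 0 (Matrix.specialUnitaryGroup (Fin 2) ℂ) | ∀ b : PBond (F.P (J + 1)) 0, dist1 ((σ U b)⁻¹ * V b) < r'}) hT hB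
  filter_upwards [hae] with U hU hUW
  refine (hU hUW).trans (measure_mono fun V hV => ⟨fun b => (hV b).trans_le hr'r, ?_⟩)
  have hσU : PlaqSmall (2 * θBal F.L γ b₀ p₀ (J + 1) - 4 * r') (σ U) :=
    fun p => ((hadm U hUW).2 p).trans_le (by linarith)
  exact plaqSmall_of_linkTube hσU hV

end Row

end Summit.QuantumFields.YangMills.Theorems.FluctuationComparisonRegPrIntLFibreTubeVolume

end
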